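import Summits.MatrixMultiplication.OmegaCensus.LocalUSPOmegaBound

/-!
# ω-census, family (b1-S): kernel row for width 9 (largest local strong USP found: 11 rows)

HONEST FRAMING (pub-omega census; verbatim): lottery ticket; floor = certified bounds/negative ranges.
Census bookkeeping, not progress on `ω`.  Sibling of `LocalUSPInstances.lean` / `LocalUSPInstancesK789.lean`; the width-9 local
strong USP census (kit j081680) reached 11 rows (kissat, 1 334 s), size 12 undecided within 1 800 s.  Same recipe: `decide +kernel`
(pattern property), `decide +kernel` (one integer inequality), `omega_le_div_of_isLocalStrongUSP` (p203819).
-/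

noncomputable section

open Literature.Computability.AlgebraicComplexity

namespace Summit.MatrixMultiplication.OmegaCensus

/-- Census row (b1-S) `w9_s11`: the local strong USP `{111222233 113122323 121123323 121223231 123113223 123212231 211222331 311213223 313112223 313212321 321213321}` (11 rows, width 9; largest size FOUND by the SAT census at this width by 2026-08-20 (s = 12 undecided within 1 800 s; see FAMILY-B-TABLE)) with modulus `m = 13` certifies `ω ≤ 2.775 = 111/40` (integer certificate `13^1080 ≤ 11^120·12^999`; exact value of the row `3(9 log 13 − log 11)/(9 log 12) = 2.7749733…`). [cite: CohnKleinbergSzegedyUmans2005, Thm. 33 and Thm. 31] -/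
theorem omega_le_of_localSUSP_w9_s11 : omega ℂ ≤ 2.775 := by
  have h := omega_le_div_of_isLocalStrongUSP (row := ![![0, 0, 0, 1, 1, 1, 1, 2, 2], ![0, 0, 2, 0, 1, 1, 2, 1, 2], ![0, 1, 0, 0, 1, 2, 2, 1, 2], ![0, 1, 0, 1, 1, 2, 1, 2, 0], ![0, 1, 2, 0, 0, 2, 1, 1, 2], ![0, 1, 2, 1, 0, 1, 1, 2, 0], ![1, 0, 0, 1, 1, 1, 2, 2, 0], ![2, 0, 0, 1, 0, 2, 1, 1, 2], ![2, 0, 2, 0, 0, 1, 1, 1, 2], ![2, 0, 2, 1, 0, 1, 2, 1, 0], ![2, 1, 0, 1, 0, 2, 2, 1, 0]])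
    (by unfold IsLocalStrongUSP localStrongUSPPatterns; decide +kernel) (by norm_num) (by norm_num)
    (m := 13) (by norm_num) (a := 111) (b := 40) (by norm_num) (by decide +kernel)
  have e : ((111 : ℕ) : ℝ) / ((40 : ℕ) : ℝ) = 2.775 := by norm_num
  rwa [e] at h

end Summit.MatrixMultiplication.OmegaCensus

end
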